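import Summits.RiemannHypothesis.RiemannHypothesis.Theorems.WeilFormatCArchSectorEntries
import Summits.RiemannHypothesis.RiemannHypothesis.Theorems.WeilFormatCPolarFormBound
import HarnessLib

/-!
# Format C, L-C3b order 1 (odd sector): the far COLUMNS of the odd kernel are `(−1)^{i+m} v⁻(i)/m + O(κ⁻(i)/m²)`

Route context: Fourier–Galerkin / Schur-complement certificates of Weil positivity on a window ("format C";
cell memo `run/shared/lean/pub/rh-explicit/rh-explicit-weil-10/FORMATC-DESIGN.md` §4.2 / §9.5; supporting
stmt-RiemannHypothesis-0098; seat rh-explicit-weil-10).  Odd-sector companion of `WeilFormatCColumnEven.lean`: the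
coupling columns of weil-2's odd SectorSplit kernel `M⁻ = (G(i,m) − G(i,−m))/2` (modes `i, m ≥ 1`; kernel indices
`k = i − 1`, `l = m − 1`) of `G = Yoshida1992.gramCoeff a`, at first order in `1/m` for `2i ≤ m` (`0 < a`;
`ω = π·/a`, `c = 1/(1+4ω²)`, `d = ω/(1+4ω²)`, `Y_i = Im ψ(¼+iω_i/2)`, `T_i = archExpSumSin a i`, `ΛΣ = Σ_kΛ(k)k^{−1/2}`,
`E = weilArchDensity(2a)`, `s² = (e^{a/2} − e^{−a/2})²`):

* `oddPolar_col_eq` — `M⁻_POL(i,m) = −(16s²/a)(−1)^{i+m} d_i d_m`; `abs_oddPolar_col_sub_le` — off `−(−1)^{i+m}4s²d_i/(πm)`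
  by `≤ (s²a²/(4π³))/m²` (`|d_m − a/(4πm)| ≤ a³/(16π³m³)`, `d_i ≤ ¼`);
* `oddPrime_col_eq` / `abs_oddPrime_col_sub_le` — `M⁻_PRI(i,m) = (−1)^{i+m}Σ_k(Λ_k/√k)(i sin ω_mℓ_k − m sin ω_iℓ_k)/(π(m²−i²))`,
  off `−(−1)^{i+m}Σ_k(Λ_k/√k) sin ω_iℓ_k/(πm)` by `≤ (2iΛΣ/π)/m²`;
* `abs_oddArch_col_sub_le` — `M⁻_ARCH(i,m)` (closed form `oddArch_offDiag_eq`) off `(−1)^{i+m}(−Y_i/(2π) + T_i/π)/m` by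
  `≤ (i/2 + 4a(1+E)/(3π²))/m²`;
* `abs_oddKernel_col_sub_le` — **`|M⁻(i,m) − (−1)^{i+m} v⁻(i)/m| ≤ κ⁻(i)/m²`**,
  `v⁻(i) = −4s²d_i/π − Σ_k(Λ_k/√k) sin(ω_iℓ_k)/π − Y_i/(2π) + T_i/π`, `κ⁻(i) = s²a²/(4π³) + 2iΛΣ/π + i/2 + 4a(1+E)/(3π²)`.

Elementary; standard axioms; no definitions; no RH claim.
-/

set_option autoImplicit false
-- `Summit.RiemannHypothesis.RiemannHypothesis.…` is the layout-mandated namespace (summit = problem name).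
set_option linter.dupNamespace false

noncomputable section

open Complex Finset
open scoped Real BigOperators ArithmeticFunction.vonMangoldt

namespace Summit.RiemannHypothesis.RiemannHypothesis.Theorems.WeilFormatC

open Literature.NumberTheory.LFunctions Literature.NumberTheory.LFunctions.Yoshida1992
open Literature.Analysis.SpecialFunctions

variable {a : ℝ}

/-- `|(−1)^{i+m}| = 1` (integer exponent). -/
theorem abs_neg_one_zpow_natCast_add' (i m : ℕ) : |(-1 : ℝ) ^ ((i : ℤ) + m)| = 1 := by
  rcases Int.even_or_odd ((i : ℤ) + m) with h | h
  · rw [h.neg_one_zpow, abs_one]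
  · rw [h.neg_one_zpow, abs_neg, abs_one]

/-- Index inequalities for `2i ≤ m`, `1 ≤ m` (odd-file copy): `m² − i² ≥ ¾m² > 0`, `i ≤ m/2`. -/
theorem col_index_bounds' {i m : ℕ} (hm : 1 ≤ m) (him : 2 * i ≤ m) :
    3 / 4 * (m : ℝ) ^ 2 ≤ (m : ℝ) ^ 2 - i ^ 2 ∧ (i : ℝ) ≤ m / 2 ∧ (0 : ℝ) < (m : ℝ) ^ 2 - i ^ 2 := by
  have hm0 : (0 : ℝ) < m := by exact_mod_cast hm
  have h2 : 2 * (i : ℝ) ≤ m := by exact_mod_cast him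
  have hi0 : (0 : ℝ) ≤ i := by positivity
  refine ⟨by nlinarith, by linarith, by nlinarith⟩

/-! ## Polar -/

section Polar

/-- **Odd polar column**: `(POL(i,m) − POL(i,−m))/2 = −(16s²/a)(−1)^{i+m} d_i d_m`. -/
theorem oddPolar_col_eq (a : ℝ) (i m : ℕ) :
    (polarCoeff a i m - polarCoeff a i (-(m : ℤ))) / 2
      = -(16 / a * (Real.exp (a / 2) - Real.exp (-(a / 2))) ^ 2) * (-1 : ℝ) ^ ((i : ℤ) + m) *
          (freq a i / (1 + 4 * freq a i ^ 2)) * (freq a m / (1 + 4 * freq a m ^ 2)) := by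
  rw [polarCoeff_eq_rankOne, polarCoeff_eq_rankOne, freq_neg, neg_one_zpow_neg',
    zpow_add₀ (by norm_num : (-1 : ℝ) ≠ 0)]
  ring

/-- `d(ω) = ω/(1+4ω²)` is within `1/(16ω³)` of `1/(4ω)` for `ω > 0`. -/
theorem abs_polarWeight_sub_le {ω : ℝ} (hω : 0 < ω) : |ω / (1 + 4 * ω ^ 2) - 1 / (4 * ω)| ≤ 1 / (16 * ω ^ 3) := by
  have e : ω / (1 + 4 * ω ^ 2) - 1 / (4 * ω) = -(1 / (4 * ω * (1 + 4 * ω ^ 2))) := by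
    field_simp
    ring
  rw [e, abs_neg, abs_of_pos (by positivity)]
  rw [div_le_div_iff₀ (by positivity) (by positivity)]
  nlinarith [hω, pow_pos hω 3]

/-- `0 ≤ d(ω) ≤ ¼` for `ω ≥ 0`. -/
theorem polarWeight_le_quarter {ω : ℝ} (hω : 0 ≤ ω) : 0 ≤ ω / (1 + 4 * ω ^ 2) ∧ ω / (1 + 4 * ω ^ 2) ≤ 1 / 4 := by
  refine ⟨by positivity, ?_⟩
  rw [div_le_div_iff₀ (by positivity) (by norm_num)]
  nlinarith [sq_nonneg (2 * ω - 1)]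

/-- **Odd polar column remainder**: `|M⁻_POL(i,m) + (−1)^{i+m}·4s²d_i/(πm)| ≤ (s²a²/(4π³))/m²` (`0 < a`, `1 ≤ i`, `1 ≤ m`). -/
theorem abs_oddPolar_col_sub_le (ha : 0 < a) {i m : ℕ} (hi : 1 ≤ i) (hm : 1 ≤ m) :
    |(polarCoeff a i m - polarCoeff a i (-(m : ℤ))) / 2
        + (-1 : ℝ) ^ ((i : ℤ) + m) * (4 * (Real.exp (a / 2) - Real.exp (-(a / 2))) ^ 2
            * (freq a i / (1 + 4 * freq a i ^ 2)) / π) / m|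
      ≤ ((Real.exp (a / 2) - Real.exp (-(a / 2))) ^ 2 * a ^ 2 / (4 * π ^ 3)) / (m : ℝ) ^ 2 := by
  rw [oddPolar_col_eq]
  have hm0 : (0 : ℝ) < m := by exact_mod_cast hm
  have hωm := freq_pos ha hm
  have hdi := polarWeight_le_quarter (freq_pos ha hi).le
  have hdm := abs_polarWeight_sub_le hωm
  set S2 := (Real.exp (a / 2) - Real.exp (-(a / 2))) ^ 2 with hS2
  set di := freq a i / (1 + 4 * freq a i ^ 2) with hdi'
  have e : -(16 / a * S2) * (-1 : ℝ) ^ ((i : ℤ) + m) * di * (freq a m / (1 + 4 * freq a m ^ 2))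
        + (-1 : ℝ) ^ ((i : ℤ) + m) * (4 * S2 * di / π) / m
      = -(16 / a * S2) * (-1 : ℝ) ^ ((i : ℤ) + m) * di *
          (freq a m / (1 + 4 * freq a m ^ 2) - 1 / (4 * freq a m)) := by
    rw [freq_natCast]
    field_simp
    ring
  rw [e, abs_mul, abs_mul, abs_mul, abs_neg_one_zpow_natCast_add', mul_one, abs_neg,
    abs_of_nonneg (by positivity : (0 : ℝ) ≤ 16 / a * S2), abs_of_nonneg hdi.1]
  calc 16 / a * S2 * di * |freq a m / (1 + 4 * freq a m ^ 2) - 1 / (4 * freq a m)|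
      ≤ 16 / a * S2 * (1 / 4) * (1 / (16 * freq a m ^ 3)) := by
        gcongr
        exact hdi.2
    _ = S2 * a ^ 2 / (4 * π ^ 3) / (m : ℝ) ^ 2 * (1 / m) := by
        rw [freq_natCast]
        field_simp
    _ ≤ S2 * a ^ 2 / (4 * π ^ 3) / (m : ℝ) ^ 2 * 1 := by
        refine mul_le_mul_of_nonneg_left ?_ (by positivity)
        rw [div_le_one hm0]; exact_mod_cast hm
    _ = S2 * a ^ 2 / (4 * π ^ 3) / (m : ℝ) ^ 2 := mul_one _

end Polar

/-! ## Prime -/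

section Prime

/-- **Odd prime column**: `(PRI(i,m) − PRI(i,−m))/2 = (−1)^{i+m} Σ_k (Λ_k/√k)(i sin ω_mℓ_k − m sin ω_iℓ_k)/(π(m²−i²))`
for `1 ≤ i < m`. -/
theorem oddPrime_col_eq (a : ℝ) {i m : ℕ} (hi : 1 ≤ i) (him : i < m) :
    (primeCoeff a i m - primeCoeff a i (-(m : ℤ))) / 2
      = (-1 : ℝ) ^ ((i : ℤ) + m) * ∑ k ∈ weilPrimeIndex a, (Λ k : ℝ) / Real.sqrt k *
          (((i : ℝ) * Real.sin (freq a m * Real.log k) - m * Real.sin (freq a i * Real.log k))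
            / (π * ((m : ℝ) ^ 2 - i ^ 2))) := by
  have hd1 : (i : ℝ) - m ≠ 0 := sub_ne_zero.mpr (by exact_mod_cast (ne_of_lt him))
  have hd1' : (m : ℝ) - i ≠ 0 := sub_ne_zero.mpr (by exact_mod_cast (ne_of_gt him))
  have hd2 : (0 : ℝ) < (i : ℝ) + m := by
    have : (1 : ℝ) ≤ i := by exact_mod_cast hi
    have : (0 : ℝ) ≤ m := by positivity
    linarith
  have hD : (m : ℝ) ^ 2 - i ^ 2 ≠ 0 := by rw [sq_sub_sq]; exact mul_ne_zero (by positivity) hd1'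
  have h1 : (i : ℤ) ≠ m := by exact_mod_cast (ne_of_lt him)
  have h2 : (i : ℤ) ≠ -(m : ℤ) := by omega
  unfold primeCoeff
  rw [← Finset.sum_sub_distrib, Finset.sum_div, Finset.mul_sum]
  refine Finset.sum_congr rfl fun k _ ↦ ?_
  unfold incrCoeff
  rw [if_neg h1, if_neg h2, if_neg h1, if_neg h2, freq_neg, neg_one_zpow_add_neg]
  push_cast
  simp only [neg_mul, Real.sin_neg, sub_neg_eq_add, sub_zero]
  have hd2' : (i : ℝ) + m ≠ 0 := hd2.ne'
  generalize (Λ k : ℝ) / Real.sqrt k = w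
  generalize Real.sin (freq a m * Real.log k) = sm
  generalize Real.sin (freq a i * Real.log k) = si
  field_simp
  ring

/-- **Odd prime column remainder**: off `−(−1)^{i+m}Σ_k(Λ_k/√k) sin ω_iℓ_k/(πm)` by `≤ (2iΛΣ/π)/m²` (`1 ≤ i`, `2i ≤ m`). -/
theorem abs_oddPrime_col_sub_le (a : ℝ) {i m : ℕ} (hi : 1 ≤ i) (him : 2 * i ≤ m) :
    |(primeCoeff a i m - primeCoeff a i (-(m : ℤ))) / 2
        + (-1 : ℝ) ^ ((i : ℤ) + m) *
          (∑ k ∈ weilPrimeIndex a, (Λ k : ℝ) / Real.sqrt k * Real.sin (freq a i * Real.log k)) / (π * m)|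
      ≤ (2 * i * (∑ k ∈ weilPrimeIndex a, (Λ k : ℝ) / Real.sqrt k) / π) / (m : ℝ) ^ 2 := by
  have hm : 1 ≤ m := by omega
  have him' : i < m := by omega
  have hm0 : (0 : ℝ) < m := by exact_mod_cast hm
  have hi0 : (0 : ℝ) ≤ i := by positivity
  obtain ⟨hD34, hihalf, hDpos⟩ := col_index_bounds' hm him
  rw [oddPrime_col_eq a hi him']
  have e : (-1 : ℝ) ^ ((i : ℤ) + m) * ∑ k ∈ weilPrimeIndex a, (Λ k : ℝ) / Real.sqrt k *
          (((i : ℝ) * Real.sin (freq a m * Real.log k) - m * Real.sin (freq a i * Real.log k))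
            / (π * ((m : ℝ) ^ 2 - i ^ 2)))
        + (-1 : ℝ) ^ ((i : ℤ) + m) *
          (∑ k ∈ weilPrimeIndex a, (Λ k : ℝ) / Real.sqrt k * Real.sin (freq a i * Real.log k)) / (π * m)
      = (-1 : ℝ) ^ ((i : ℤ) + m) * ∑ k ∈ weilPrimeIndex a, (Λ k : ℝ) / Real.sqrt k *
          ((((i : ℝ) * Real.sin (freq a m * Real.log k) - m * Real.sin (freq a i * Real.log k))
            / (π * ((m : ℝ) ^ 2 - i ^ 2))) + Real.sin (freq a i * Real.log k) / (π * m)) := by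
    rw [mul_div_assoc, Finset.sum_div, ← mul_add, ← Finset.sum_add_distrib]
    congr 1
    exact Finset.sum_congr rfl fun k _ ↦ by ring
  rw [e, abs_mul, abs_neg_one_zpow_natCast_add', one_mul]
  have hK : ∀ k ∈ weilPrimeIndex a,
      |(Λ k : ℝ) / Real.sqrt k *
        ((((i : ℝ) * Real.sin (freq a m * Real.log k) - m * Real.sin (freq a i * Real.log k))
          / (π * ((m : ℝ) ^ 2 - i ^ 2))) + Real.sin (freq a i * Real.log k) / (π * m))|
        ≤ (Λ k : ℝ) / Real.sqrt k * (2 * i / (π * m ^ 2)) := by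
    intro k _
    have hw : 0 ≤ (Λ k : ℝ) / Real.sqrt k := div_nonneg ArithmeticFunction.vonMangoldt_nonneg (Real.sqrt_nonneg _)
    rw [abs_mul, abs_of_nonneg hw]
    refine mul_le_mul_of_nonneg_left ?_ hw
    have hsm := Real.abs_sin_le_one (freq a m * Real.log k)
    have hsi := Real.abs_sin_le_one (freq a i * Real.log k)
    generalize Real.sin (freq a m * Real.log k) = sm at hsm ⊢
    generalize Real.sin (freq a i * Real.log k) = si at hsi ⊢
    have e : ((i : ℝ) * sm - m * si) / (π * ((m : ℝ) ^ 2 - i ^ 2)) + si / (π * m)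
        = ((i : ℝ) * m * sm - i ^ 2 * si) / (π * m * ((m : ℝ) ^ 2 - i ^ 2)) := by
      field_simp
      ring
    rw [e, abs_div, abs_of_pos (by positivity : (0 : ℝ) < π * m * ((m : ℝ) ^ 2 - i ^ 2)),
      div_le_div_iff₀ (by positivity) (by positivity)]
    have hnum : |(i : ℝ) * m * sm - i ^ 2 * si| ≤ (i : ℝ) * m + i ^ 2 := by
      have h1 : |(i : ℝ) * m * sm| ≤ (i : ℝ) * m := by
        rw [abs_mul, abs_of_nonneg (by positivity : (0 : ℝ) ≤ (i : ℝ) * m)]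
        exact mul_le_of_le_one_right (by positivity) hsm
      have h2 : |(i : ℝ) ^ 2 * si| ≤ (i : ℝ) ^ 2 := by
        rw [abs_mul, abs_of_nonneg (by positivity : (0 : ℝ) ≤ (i : ℝ) ^ 2)]
        exact mul_le_of_le_one_right (by positivity) hsi
      exact (abs_sub _ _).trans (add_le_add h1 h2)
    have hlhs := mul_le_mul_of_nonneg_right hnum (by positivity : (0 : ℝ) ≤ π * m ^ 2)
    refine hlhs.trans ?_
    have h2i : (0 : ℝ) ≤ m - 2 * i := by
      have : 2 * (i : ℝ) ≤ m := by exact_mod_cast him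
      linarith
    have key : 0 ≤ π * i * m * ((m : ℝ) + i) * (m - 2 * i) := by positivity
    nlinarith [key]
  refine (Finset.abs_sum_le_sum_abs _ _).trans ((Finset.sum_le_sum hK).trans (le_of_eq ?_))
  rw [← Finset.sum_mul]
  field_simp

end Prime

/-! ## Archimedean -/

section Arch

/-- **Odd archimedean column remainder**: `|M⁻_ARCH(i,m) − (−1)^{i+m}(−Y_i/(2π) + T_i/π)/m| ≤ (i/2 + 4a(1+E)/(3π²))/m²`
(`0 < a`, `1 ≤ i`, `2i ≤ m`). -/
theorem abs_oddArch_col_sub_le (ha : 0 < a) {i m : ℕ} (hi : 1 ≤ i) (him : 2 * i ≤ m) :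
    |(archCoeff a i m - archCoeff a i (-(m : ℤ))) / 2
        - (-1 : ℝ) ^ ((i : ℤ) + m) *
          (-(Complex.digamma (1 / 4 + ((freq a i : ℝ) : ℂ) / 2 * I)).im / (2 * π) + archExpSumSin a i / π) / m|
      ≤ ((i : ℝ) / 2 + 4 * a * (1 + weilArchDensity (2 * a)) / (3 * π ^ 2)) / (m : ℝ) ^ 2 := by
  have hm : 1 ≤ m := by omega
  have him' : i < m := by omega
  have hm0 : (0 : ℝ) < m := by exact_mod_cast hm
  have hi0 : (0 : ℝ) < i := by exact_mod_cast hi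
  obtain ⟨hD34, hihalf, hDpos⟩ := col_index_bounds' hm him
  rw [oddArch_offDiag_eq a hi hm (ne_of_lt him')]
  have hE0 : 0 < weilArchDensity (2 * a) := weilArchDensity_pos (by positivity)
  -- row/column inputs
  have hYi : |(Complex.digamma (1 / 4 + ((freq a i : ℝ) : ℂ) / 2 * I)).im| ≤ π / 2 + 2 * a / (π * i) := by
    have := abs_sub_abs_le_abs_sub (Complex.digamma (1 / 4 + ((freq a i : ℝ) : ℂ) / 2 * I)).im (π / 2)
    rw [abs_of_pos (by positivity : (0 : ℝ) < π / 2)] at this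
    linarith [abs_im_digamma_freq_sub_le ha hi]
  have hYm : |(Complex.digamma (1 / 4 + ((freq a m : ℝ) : ℂ) / 2 * I)).im| ≤ π / 2 + 2 * a / (π * m) := by
    have := abs_sub_abs_le_abs_sub (Complex.digamma (1 / 4 + ((freq a m : ℝ) : ℂ) / 2 * I)).im (π / 2)
    rw [abs_of_pos (by positivity : (0 : ℝ) < π / 2)] at this
    linarith [abs_im_digamma_freq_sub_le ha hm]
  have hTi0 := archExpSumSin_nonneg ha hi
  have hTi := archExpSumSin_le ha hi
  have hTm0 := archExpSumSin_nonneg ha hm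
  have hTm := archExpSumSin_le ha hm
  generalize (Complex.digamma (1 / 4 + ((freq a i : ℝ) : ℂ) / 2 * I)).im = Yi at hYi ⊢
  generalize (Complex.digamma (1 / 4 + ((freq a m : ℝ) : ℂ) / 2 * I)).im = Ym at hYm ⊢
  generalize archExpSumSin a i = Ti at hTi0 hTi ⊢
  generalize archExpSumSin a m = Tm at hTm0 hTm ⊢
  generalize weilArchDensity (2 * a) = E at hE0 hTi hTm ⊢
  -- subtract the main part: the rest is  iY_m/(2πD) − i²Y_i/(2πmD) − iT_m/(πD) + i²T_i/(πmD)
  have e : (-1 : ℝ) ^ ((i : ℤ) + m) *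
        (((m : ℝ) * Yi - i * Ym) / (2 * π * ((i : ℝ) ^ 2 - m ^ 2)) - ((m : ℝ) * Ti - i * Tm) / (π * ((i : ℝ) ^ 2 - m ^ 2)))
        - (-1 : ℝ) ^ ((i : ℤ) + m) * (-Yi / (2 * π) + Ti / π) / m
      = (-1 : ℝ) ^ ((i : ℤ) + m) *
        ((i : ℝ) * Ym / (2 * π * ((m : ℝ) ^ 2 - i ^ 2))
          - (i : ℝ) ^ 2 * Yi / (2 * π * m * ((m : ℝ) ^ 2 - i ^ 2))
          - (i : ℝ) * Tm / (π * ((m : ℝ) ^ 2 - i ^ 2))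
          + (i : ℝ) ^ 2 * Ti / (π * m * ((m : ℝ) ^ 2 - i ^ 2))) := by
    have hD' : (i : ℝ) ^ 2 - m ^ 2 ≠ 0 := by
      rw [show (i : ℝ) ^ 2 - m ^ 2 = -((m : ℝ) ^ 2 - i ^ 2) by ring]; exact neg_ne_zero.mpr hDpos.ne'
    field_simp
    ring
  rw [e, abs_mul, abs_neg_one_zpow_natCast_add', one_mul]
  generalize (m : ℝ) ^ 2 - (i : ℝ) ^ 2 = D at hD34 hDpos ⊢
  have b1 : |(i : ℝ) * Ym / (2 * π * D)| ≤ (i * (π / 2 + 2 * a / (π * m))) / (2 * π * D) := by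
    rw [abs_div, abs_of_pos (by positivity : (0 : ℝ) < 2 * π * D), abs_mul, abs_of_pos hi0]
    exact div_le_div_of_nonneg_right (mul_le_mul_of_nonneg_left hYm hi0.le) (by positivity)
  have b2 : |(i : ℝ) ^ 2 * Yi / (2 * π * m * D)| ≤ ((i : ℝ) ^ 2 * (π / 2 + 2 * a / (π * i))) / (2 * π * m * D) := by
    rw [abs_div, abs_of_pos (by positivity : (0 : ℝ) < 2 * π * m * D), abs_mul,
      abs_of_pos (by positivity : (0 : ℝ) < (i : ℝ) ^ 2)]
    exact div_le_div_of_nonneg_right (mul_le_mul_of_nonneg_left hYi (by positivity)) (by positivity)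
  have b3 : |(i : ℝ) * Tm / (π * D)| ≤ (i * (E * a / (π * m))) / (π * D) := by
    rw [abs_div, abs_of_pos (by positivity : (0 : ℝ) < π * D), abs_mul, abs_of_pos hi0, abs_of_nonneg hTm0]
    exact div_le_div_of_nonneg_right (mul_le_mul_of_nonneg_left hTm hi0.le) (by positivity)
  have b4 : |(i : ℝ) ^ 2 * Ti / (π * m * D)| ≤ ((i : ℝ) ^ 2 * (E * a / (π * i))) / (π * m * D) := by
    rw [abs_div, abs_of_pos (by positivity : (0 : ℝ) < π * m * D), abs_mul,
      abs_of_pos (by positivity : (0 : ℝ) < (i : ℝ) ^ 2), abs_of_nonneg hTi0]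
    exact div_le_div_of_nonneg_right (mul_le_mul_of_nonneg_left hTi (by positivity)) (by positivity)
  have tri : |(i : ℝ) * Ym / (2 * π * D) - (i : ℝ) ^ 2 * Yi / (2 * π * m * D) - (i : ℝ) * Tm / (π * D)
          + (i : ℝ) ^ 2 * Ti / (π * m * D)|
      ≤ (i * (π / 2 + 2 * a / (π * m))) / (2 * π * D) + ((i : ℝ) ^ 2 * (π / 2 + 2 * a / (π * i))) / (2 * π * m * D)
        + (i * (E * a / (π * m))) / (π * D) + ((i : ℝ) ^ 2 * (E * a / (π * i))) / (π * m * D) := by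
    have t1 := abs_sub ((i : ℝ) * Ym / (2 * π * D)) ((i : ℝ) ^ 2 * Yi / (2 * π * m * D))
    have t2 := abs_sub ((i : ℝ) * Ym / (2 * π * D) - (i : ℝ) ^ 2 * Yi / (2 * π * m * D)) ((i : ℝ) * Tm / (π * D))
    have t3 := abs_add_le ((i : ℝ) * Ym / (2 * π * D) - (i : ℝ) ^ 2 * Yi / (2 * π * m * D) - (i : ℝ) * Tm / (π * D))
      ((i : ℝ) ^ 2 * Ti / (π * m * D))
    linarith
  refine tri.trans ?_
  -- explicit sum = [ iπ/4·(1 + i/m)·… ] ≤ (i/2 + 4a(1+E)/(3π²))/m² using D ≥ ¾m², i ≤ m/2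
  have esum : (i * (π / 2 + 2 * a / (π * m))) / (2 * π * D) + ((i : ℝ) ^ 2 * (π / 2 + 2 * a / (π * i))) / (2 * π * m * D)
      + (i * (E * a / (π * m))) / (π * D) + ((i : ℝ) ^ 2 * (E * a / (π * i))) / (π * m * D)
      = ((i : ℝ) / 4 * (1 + i / m) + a * (1 + E) / π ^ 2 * (2 * i / m)) / D := by
    field_simp
    ring
  rw [esum]
  have him2 : (i : ℝ) / m ≤ 1 / 2 := by
    rw [div_le_iff₀ hm0]; linarith
  have hnum : (i : ℝ) / 4 * (1 + i / m) + a * (1 + E) / π ^ 2 * (2 * i / m)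
      ≤ 3 * i / 8 + a * (1 + E) / π ^ 2 := by
    have h1 : (i : ℝ) / 4 * (1 + i / m) ≤ (i : ℝ) / 4 * (1 + 1 / 2) :=
      mul_le_mul_of_nonneg_left (by linarith) (by positivity)
    have h2 : a * (1 + E) / π ^ 2 * (2 * i / m) ≤ a * (1 + E) / π ^ 2 * 1 := by
      refine mul_le_mul_of_nonneg_left ?_ (by positivity)
      rw [mul_div_assoc]; linarith
    linarith
  have hnum0 : 0 ≤ 3 * (i : ℝ) / 8 + a * (1 + E) / π ^ 2 := by positivity
  calc ((i : ℝ) / 4 * (1 + i / m) + a * (1 + E) / π ^ 2 * (2 * i / m)) / D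
      ≤ (3 * i / 8 + a * (1 + E) / π ^ 2) / D := div_le_div_of_nonneg_right hnum hDpos.le
    _ ≤ (3 * i / 8 + a * (1 + E) / π ^ 2) / (3 / 4 * (m : ℝ) ^ 2) :=
        div_le_div_of_nonneg_left hnum0 (by positivity) hD34
    _ = ((i : ℝ) / 2 + 4 * a * (1 + E) / (3 * π ^ 2)) / (m : ℝ) ^ 2 := by
        field_simp
        ring

end Arch

/-! ## The odd kernel column -/

section Kernel

/-- **Order-1 column structure, odd sector.**  For `a > 0`, `1 ≤ i`, `2i ≤ m` (modes; kernel indices `i−1`, `m−1`):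
`|M⁻_{gramCoeff a}(i,m) − (−1)^{i+m} v⁻(i)/m| ≤ κ⁻(i)/m²` with
`v⁻(i) = −4s²d_i/π − Σ_k(Λ_k/√k) sin(ω_iℓ_k)/π − Y_i/(2π) + T_i/π` and `κ⁻(i) = s²a²/(4π³) + 2iΛΣ/π + i/2 + 4a(1+E)/(3π²)`. -/
theorem abs_oddKernel_col_sub_le (ha : 0 < a) {i m : ℕ} (hi : 1 ≤ i) (him : 2 * i ≤ m) :
    |(gramCoeff a i m - gramCoeff a i (-(m : ℤ))) / 2
        - (-1 : ℝ) ^ ((i : ℤ) + m) *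
          (-(4 * (Real.exp (a / 2) - Real.exp (-(a / 2))) ^ 2 * (freq a i / (1 + 4 * freq a i ^ 2)) / π)
            - (∑ k ∈ weilPrimeIndex a, (Λ k : ℝ) / Real.sqrt k * Real.sin (freq a i * Real.log k)) / π
            - (Complex.digamma (1 / 4 + ((freq a i : ℝ) : ℂ) / 2 * I)).im / (2 * π) + archExpSumSin a i / π) / m|
      ≤ ((Real.exp (a / 2) - Real.exp (-(a / 2))) ^ 2 * a ^ 2 / (4 * π ^ 3)
          + 2 * i * (∑ k ∈ weilPrimeIndex a, (Λ k : ℝ) / Real.sqrt k) / π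
          + ((i : ℝ) / 2 + 4 * a * (1 + weilArchDensity (2 * a)) / (3 * π ^ 2))) / (m : ℝ) ^ 2 := by
  have hm : 1 ≤ m := by omega
  have hm0 : (0 : ℝ) < m := by exact_mod_cast hm
  have hP := abs_oddPolar_col_sub_le ha hi hm
  have hQ := abs_oddPrime_col_sub_le a hi him
  have hR := abs_oddArch_col_sub_le ha hi him
  have e : (gramCoeff a i m - gramCoeff a i (-(m : ℤ))) / 2
        - (-1 : ℝ) ^ ((i : ℤ) + m) *
          (-(4 * (Real.exp (a / 2) - Real.exp (-(a / 2))) ^ 2 * (freq a i / (1 + 4 * freq a i ^ 2)) / π)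
            - (∑ k ∈ weilPrimeIndex a, (Λ k : ℝ) / Real.sqrt k * Real.sin (freq a i * Real.log k)) / π
            - (Complex.digamma (1 / 4 + ((freq a i : ℝ) : ℂ) / 2 * I)).im / (2 * π) + archExpSumSin a i / π) / m
      = ((polarCoeff a i m - polarCoeff a i (-(m : ℤ))) / 2
          + (-1 : ℝ) ^ ((i : ℤ) + m) * (4 * (Real.exp (a / 2) - Real.exp (-(a / 2))) ^ 2
              * (freq a i / (1 + 4 * freq a i ^ 2)) / π) / m)
        + ((primeCoeff a i m - primeCoeff a i (-(m : ℤ))) / 2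
          + (-1 : ℝ) ^ ((i : ℤ) + m) *
            (∑ k ∈ weilPrimeIndex a, (Λ k : ℝ) / Real.sqrt k * Real.sin (freq a i * Real.log k)) / (π * m))
        + ((archCoeff a i m - archCoeff a i (-(m : ℤ))) / 2
          - (-1 : ℝ) ^ ((i : ℤ) + m) *
            (-(Complex.digamma (1 / 4 + ((freq a i : ℝ) : ℂ) / 2 * I)).im / (2 * π) + archExpSumSin a i / π) / m) := by
    unfold gramCoeff
    field_simp
    ring
  rw [e]
  refine ((abs_add_le _ _).trans (add_le_add ((abs_add_le _ _).trans (add_le_add hP hQ)) hR)).trans (le_of_eq ?_)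
  ring

end Kernel

end Summit.RiemannHypothesis.RiemannHypothesis.Theorems.WeilFormatC

end
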